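import Mathlib
import Summits.Ventures.PercRepro2.ExplorationTreeStep

/-!
# The between term of a stopping exploration is the sum of its one-edge steps (blind cell
PercRepro2, typer-1 g21; a language line)

`ExplorationTreeStep.lean` computed the increment of the between term `cov[leafMean t f,
leafMean t g]` under one more revealed edge.  Iterating along the tree: the between term of ANY
stopping exploration is the sum, over its internal nodes `(h, e)` (a history `h` = the partial
configuration at the node, `e` = the edge revealed there), of the one-edge steps
`P(h) · p_e (1 − p_e) · (E_{h, e↦1} f − E_{h, e↦0} f)(E_{h, e↦1} g − E_{h, e↦0} g)`.

* `stepSum p f g t P`: the step sum of `t` started at `P`, defined by recursion on the tree (the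
  node term plus the two branch sums weighted by `1 − p_e` and `p_e`) — unfolding the recursion,
  the node `(h, e)` is reached with probability `P_{pin P}(h)` = the product of the branch weights
  down to it;
* `centered_sum_recenter`: moving the centre of a leaf-weighted centred sum;
* **`centered_leaf_sum_eq_stepSum`**: for `t` valid at `P`,
  `Σ_{ℓ ∈ leaves t P} P_{pin P}(ℓ) (E_{pin ℓ} f − E_{pin P} f)(E_{pin ℓ} g − E_{pin P} g)
     = stepSum p f g t P`;
* **`covariance_leafMean_eq_stepSum`**:
  `cov[leafMean t f, leafMean t g; μ_p] = stepSum p f g t root` — the between term IS the sum of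
  the one-edge steps along the exploration;
* **`stepSum_nonneg_of_steps_nonneg`** / **`covariance_leafMean_nonneg_of_steps_nonneg`**: if at
  every history and every next edge the two pinned increments of `f` and `g` have the same sign,
  the between term of every stopping exploration is `≥ 0` (the "monotone potential" reading);
  `stepSum_nonpos_of_steps_nonpos` likewise for `≤ 0`;
* **`StepsNonneg`** / **`covariance_leafMean_nonneg_of_stepsNonneg`** (the rule-specific form): if
  every step ALONG THIS exploration `t` is `≥ 0`, the between term of `t` is `≥ 0`
  (`stepsNonneg_of_forall`: the global hypothesis gives it for every exploration).

Identities and the sign transfers; nothing here decides the sign of any step.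
-/

namespace Summit.Ventures.PercRepro2

open MeasureTheory ProbabilityTheory MeasureBridge

namespace ExplorationTree

section StepSum

variable {E : Type*} [Fintype E] [DecidableEq E]

/-- The one-edge step of the between term at the history `P` across the edge `e`:
`p_e (1 − p_e) (E_{P, e↦1} f − E_{P, e↦0} f)(E_{P, e↦1} g − E_{P, e↦0} g)`. -/
noncomputable def step (p : E → ℝ) (f g : Config E → ℝ) (P : Partial E) (e : E) : ℝ :=
  p e * (1 - p e) *
    (expect (Function.update (pin p P) e 1) f - expect (Function.update (pin p P) e 0) f) *
    (expect (Function.update (pin p P) e 1) g - expect (Function.update (pin p P) e 0) g)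

/-- The step sum of the exploration `t` started at `P`: the step at the root node plus the step
sums of the two branches weighted by the branch probabilities `1 − p_e` (closed) and `p_e` (open).
Unfolded, it is `Σ_{(h, e) internal node} P_{pin P}(h) · step p f g h e`. -/
noncomputable def stepSum (p : E → ℝ) (f g : Config E → ℝ) : ETree E → Partial E → ℝ
  | .leaf, _ => 0
  | .node e t₀ t₁, P =>
      step p f g P e + (1 - p e) * stepSum p f g t₀ (P.extend e false)
        + p e * stepSum p f g t₁ (P.extend e true)

/-- `stepSum` at a leaf. -/
@[simp] lemma stepSum_leaf (p : E → ℝ) (f g : Config E → ℝ) (P : Partial E) :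
    stepSum p f g .leaf P = 0 := rfl

/-- `stepSum` at a node. -/
lemma stepSum_node (p : E → ℝ) (f g : Config E → ℝ) (e : E) (t₀ t₁ : ETree E) (P : Partial E) :
    stepSum p f g (.node e t₀ t₁) P =
      step p f g P e + (1 - p e) * stepSum p f g t₀ (P.extend e false)
        + p e * stepSum p f g t₁ (P.extend e true) := rfl

/-- The centred leaf sum of `t` started at `P'`, with the centre `(A, B)` instead of
`(E_{pin P'} f, E_{pin P'} g)`: the own-centred sum plus `(E_{pin P'} f − A)(E_{pin P'} g − B)`. -/
lemma centered_sum_recenter (p : E → ℝ) (t : ETree E) (P' : Partial E) (hv : Valid t P'.F)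
    (f g : Config E → ℝ) (A B : ℝ) :
    ((leaves t P').map fun ℓ => prob (pin p P') ℓ.event *
        ((expect (pin p ℓ) f - A) * (expect (pin p ℓ) g - B))).sum =
      ((leaves t P').map fun ℓ => prob (pin p P') ℓ.event *
        ((expect (pin p ℓ) f - expect (pin p P') f) *
          (expect (pin p ℓ) g - expect (pin p P') g))).sum +
      (expect (pin p P') f - A) * (expect (pin p P') g - B) := by
  rw [sum_map_mul_sub_mul_sub, sum_map_mul_sub_mul_sub, sum_leaves_prob_pin p t P' hv,
    ← expect_pin_eq_sum_leaves_pin p t P' hv f, ← expect_pin_eq_sum_leaves_pin p t P' hv g]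
  ring

/-- The probability, under the pinned law of `P`, of the closed extension is `1 − p_e`. -/
lemma prob_pin_extend_false (p : E → ℝ) (P : Partial E) {e : E} (he : e ∉ P.F) :
    prob (pin p P) (P.extend e false).event = 1 - p e := by
  rw [extend_event_false P he, prob_pin_inter_event, prob_closedEdge, pin_of_notMem p P he]

/-- The probability, under the pinned law of `P`, of the open extension is `p_e`. -/
lemma prob_pin_extend_true (p : E → ℝ) (P : Partial E) {e : E} (he : e ∉ P.F) :
    prob (pin p P) (P.extend e true).event = p e := by
  rw [extend_event_true P he, prob_pin_inter_event, prob_openEdge, pin_of_notMem p P he]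

omit [Fintype E] in
/-- Pinning twice along an extension is pinning once. -/
lemma pin_pin_extend (p : E → ℝ) (P : Partial E) (e : E) (b : Bool) :
    pin (pin p P) (P.extend e b) = pin p (P.extend e b) :=
  pin_pin p P (P.extend e b) (Finset.subset_insert e P.F)

/-- The leaf sum of a branch, weighted from the node: for `ℓ` a leaf of `t₀` started at
`P.extend e b`, `P_{pin P}(ℓ) = P_{pin P}(P.extend e b) · P_{pin (P.extend e b)}(ℓ)`. -/
lemma sum_leaves_branch (p : E → ℝ) (t : ETree E) (P : Partial E) (e : E) (b : Bool)
    (hv : Valid t (P.extend e b).F) (c : Partial E → ℝ) :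
    ((leaves t (P.extend e b)).map fun ℓ => prob (pin p P) ℓ.event * c ℓ).sum =
      prob (pin p P) (P.extend e b).event *
        ((leaves t (P.extend e b)).map fun ℓ => prob (pin p (P.extend e b)) ℓ.event * c ℓ).sum := by
  rw [← List.sum_map_mul_left]
  congr 1
  refine List.map_congr_left fun ℓ hℓ => ?_
  rw [prob_event_eq_mul_of_mem_leaves (pin p P) t (P.extend e b) hv hℓ, pin_pin_extend]
  ring

/-- **The centred leaf sum is the step sum**: for `t` valid at `P`,
`Σ_{ℓ ∈ leaves t P} P_{pin P}(ℓ) (E_{pin ℓ} f − E_{pin P} f)(E_{pin ℓ} g − E_{pin P} g)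
  = stepSum p f g t P`. -/
theorem centered_leaf_sum_eq_stepSum (p : E → ℝ) (f g : Config E → ℝ) (t : ETree E) :
    ∀ (P : Partial E), Valid t P.F →
      ((leaves t P).map fun ℓ => prob (pin p P) ℓ.event *
        ((expect (pin p ℓ) f - expect (pin p P) f) *
          (expect (pin p ℓ) g - expect (pin p P) g))).sum = stepSum p f g t P := by
  induction t with
  | leaf =>
    intro P _
    simp [leaves, stepSum_leaf]
  | node e t₀ t₁ ih₀ ih₁ =>
    intro P hv
    obtain ⟨he, hv₀, hv₁⟩ := hv
    rw [stepSum_node]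
    simp only [leaves, List.map_append, List.sum_append]
    rw [sum_leaves_branch p t₀ P e false hv₀, sum_leaves_branch p t₁ P e true hv₁,
      centered_sum_recenter p t₀ (P.extend e false) hv₀,
      centered_sum_recenter p t₁ (P.extend e true) hv₁,
      ih₀ (P.extend e false) hv₀, ih₁ (P.extend e true) hv₁, prob_pin_extend_false p P he,
      prob_pin_extend_true p P he, pin_extend_true, pin_extend_false, expect_eq_pin (pin p P) f e,
      expect_eq_pin (pin p P) g e, pin_of_notMem p P he]
    unfold step
    ring

omit [Fintype E] in
/-- Pinning at the root changes nothing. -/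
lemma pin_root (p : E → ℝ) : pin p root = p := by
  funext e
  simp [pin, root]

/-- **The between term is the sum of the one-edge steps along the exploration**: for every valid
stopping exploration `t` and every weight vector,
`cov[leafMean p t f, leafMean p t g; μ_p] = stepSum p f g t root`. -/
theorem covariance_leafMean_eq_stepSum (p : E → ℝ) (hp : IsProbVec p) (t : ETree E)
    (hv : Valid t ∅) (f g : Config E → ℝ) :
    cov[leafMean p t f, leafMean p t g; percMeasureOf p hp] = stepSum p f g t root := by
  rw [covariance_leafMean_centered p hp t hv f g, ← centered_leaf_sum_eq_stepSum p f g t root hv,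
    pin_root]

end StepSum

/-! ## The sign transfer: same-sign increments at every step give a nonnegative between term -/

section Sign

variable {E : Type*} [Fintype E] [DecidableEq E]

/-- A step is `≥ 0` when the two pinned increments have the same sign (`0 ≤ p_e ≤ 1`). -/
lemma step_nonneg {p : E → ℝ} (hp : IsProbVec p) (f g : Config E → ℝ) (P : Partial E) (e : E)
    (h : 0 ≤ (expect (Function.update (pin p P) e 1) f - expect (Function.update (pin p P) e 0) f) *
      (expect (Function.update (pin p P) e 1) g - expect (Function.update (pin p P) e 0) g)) :
    0 ≤ step p f g P e := by
  unfold step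
  rw [mul_assoc]
  exact mul_nonneg (mul_nonneg (hp.nonneg e) (sub_nonneg.mpr (hp.le_one e))) h

/-- A step is `≤ 0` when the two pinned increments have opposite signs (`0 ≤ p_e ≤ 1`). -/
lemma step_nonpos {p : E → ℝ} (hp : IsProbVec p) (f g : Config E → ℝ) (P : Partial E) (e : E)
    (h : (expect (Function.update (pin p P) e 1) f - expect (Function.update (pin p P) e 0) f) *
      (expect (Function.update (pin p P) e 1) g - expect (Function.update (pin p P) e 0) g) ≤ 0) :
    step p f g P e ≤ 0 := by
  unfold step
  rw [mul_assoc]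
  exact mul_nonpos_of_nonneg_of_nonpos (mul_nonneg (hp.nonneg e) (sub_nonneg.mpr (hp.le_one e))) h

/-- **Same-sign increments at every step give a nonnegative step sum**: if for every history `P`
and every edge `e` the two pinned increments of `f` and `g` across `e` have the same sign, then
`0 ≤ stepSum p f g t P` for every tree `t` and every start `P`. -/
theorem stepSum_nonneg_of_steps_nonneg {p : E → ℝ} (hp : IsProbVec p) (f g : Config E → ℝ)
    (hstep : ∀ (P : Partial E) (e : E),
      0 ≤ (expect (Function.update (pin p P) e 1) f - expect (Function.update (pin p P) e 0) f) *
        (expect (Function.update (pin p P) e 1) g - expect (Function.update (pin p P) e 0) g))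
    (t : ETree E) : ∀ P : Partial E, 0 ≤ stepSum p f g t P := by
  induction t with
  | leaf =>
    intro P
    rw [stepSum_leaf]
  | node e t₀ t₁ ih₀ ih₁ =>
    intro P
    rw [stepSum_node]
    have h1 := step_nonneg hp f g P e (hstep P e)
    have h2 := mul_nonneg (sub_nonneg.mpr (hp.le_one e)) (ih₀ (P.extend e false))
    have h3 := mul_nonneg (hp.nonneg e) (ih₁ (P.extend e true))
    linarith

/-- Opposite-sign increments at every step give a nonpositive step sum. -/
theorem stepSum_nonpos_of_steps_nonpos {p : E → ℝ} (hp : IsProbVec p) (f g : Config E → ℝ)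
    (hstep : ∀ (P : Partial E) (e : E),
      (expect (Function.update (pin p P) e 1) f - expect (Function.update (pin p P) e 0) f) *
        (expect (Function.update (pin p P) e 1) g - expect (Function.update (pin p P) e 0) g) ≤ 0)
    (t : ETree E) : ∀ P : Partial E, stepSum p f g t P ≤ 0 := by
  induction t with
  | leaf =>
    intro P
    rw [stepSum_leaf]
  | node e t₀ t₁ ih₀ ih₁ =>
    intro P
    rw [stepSum_node]
    have h1 := step_nonpos hp f g P e (hstep P e)
    have h2 := mul_nonpos_of_nonneg_of_nonpos (sub_nonneg.mpr (hp.le_one e))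
      (ih₀ (P.extend e false))
    have h3 := mul_nonpos_of_nonneg_of_nonpos (hp.nonneg e) (ih₁ (P.extend e true))
    linarith

/-- **The monotone-potential reading**: if at every history and every edge the two pinned
increments of `f` and `g` have the same sign, the between term of every stopping exploration is
nonnegative. -/
theorem covariance_leafMean_nonneg_of_steps_nonneg {p : E → ℝ} (hp : IsProbVec p)
    (f g : Config E → ℝ)
    (hstep : ∀ (P : Partial E) (e : E),
      0 ≤ (expect (Function.update (pin p P) e 1) f - expect (Function.update (pin p P) e 0) f) *
        (expect (Function.update (pin p P) e 1) g - expect (Function.update (pin p P) e 0) g))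
    (t : ETree E) (hv : Valid t ∅) :
    0 ≤ cov[leafMean p t f, leafMean p t g; percMeasureOf p hp] := by
  rw [covariance_leafMean_eq_stepSum p hp t hv f g]
  exact stepSum_nonneg_of_steps_nonneg hp f g hstep t root

/-- The opposite reading: opposite-sign increments at every step give a nonpositive between term. -/
theorem covariance_leafMean_nonpos_of_steps_nonpos {p : E → ℝ} (hp : IsProbVec p)
    (f g : Config E → ℝ)
    (hstep : ∀ (P : Partial E) (e : E),
      (expect (Function.update (pin p P) e 1) f - expect (Function.update (pin p P) e 0) f) *
        (expect (Function.update (pin p P) e 1) g - expect (Function.update (pin p P) e 0) g) ≤ 0)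
    (t : ETree E) (hv : Valid t ∅) :
    cov[leafMean p t f, leafMean p t g; percMeasureOf p hp] ≤ 0 := by
  rw [covariance_leafMean_eq_stepSum p hp t hv f g]
  exact stepSum_nonpos_of_steps_nonpos hp f g hstep t root

end Sign

/-! ## The rule-specific form: nonnegative steps along THIS exploration -/

section Rule

variable {E : Type*} [Fintype E] [DecidableEq E]

/-- `StepsNonneg p f g t P`: along the exploration `t` started at `P`, every node's two pinned
increments have the same sign (the step at every visited history and revealed edge is `≥ 0`). -/
def StepsNonneg (p : E → ℝ) (f g : Config E → ℝ) : ETree E → Partial E → Prop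
  | .leaf, _ => True
  | .node e t₀ t₁, P =>
      0 ≤ (expect (Function.update (pin p P) e 1) f - expect (Function.update (pin p P) e 0) f) *
          (expect (Function.update (pin p P) e 1) g - expect (Function.update (pin p P) e 0) g) ∧
        StepsNonneg p f g t₀ (P.extend e false) ∧ StepsNonneg p f g t₁ (P.extend e true)

/-- **Nonnegative steps along an exploration give a nonnegative step sum** (`0 ≤ p_e ≤ 1`). -/
theorem stepSum_nonneg_of_stepsNonneg {p : E → ℝ} (hp : IsProbVec p) (f g : Config E → ℝ)
    (t : ETree E) : ∀ P : Partial E, StepsNonneg p f g t P → 0 ≤ stepSum p f g t P := by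
  induction t with
  | leaf =>
    intro P _
    rw [stepSum_leaf]
  | node e t₀ t₁ ih₀ ih₁ =>
    intro P hs
    obtain ⟨h, hs₀, hs₁⟩ := hs
    rw [stepSum_node]
    have h1 := step_nonneg hp f g P e h
    have h2 := mul_nonneg (sub_nonneg.mpr (hp.le_one e)) (ih₀ (P.extend e false) hs₀)
    have h3 := mul_nonneg (hp.nonneg e) (ih₁ (P.extend e true) hs₁)
    linarith

/-- **The rule-specific monotone-potential reading**: if every step of the stopping exploration
`t` is nonnegative, its between term is nonnegative. -/
theorem covariance_leafMean_nonneg_of_stepsNonneg {p : E → ℝ} (hp : IsProbVec p)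
    (f g : Config E → ℝ) (t : ETree E) (hv : Valid t ∅) (hs : StepsNonneg p f g t root) :
    0 ≤ cov[leafMean p t f, leafMean p t g; percMeasureOf p hp] := by
  rw [covariance_leafMean_eq_stepSum p hp t hv f g]
  exact stepSum_nonneg_of_stepsNonneg hp f g t root hs

/-- The global hypothesis implies the rule-specific one for every exploration. -/
lemma stepsNonneg_of_forall (p : E → ℝ) (f g : Config E → ℝ)
    (hstep : ∀ (P : Partial E) (e : E),
      0 ≤ (expect (Function.update (pin p P) e 1) f - expect (Function.update (pin p P) e 0) f) *
        (expect (Function.update (pin p P) e 1) g - expect (Function.update (pin p P) e 0) g))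
    (t : ETree E) : ∀ P : Partial E, StepsNonneg p f g t P := by
  induction t with
  | leaf =>
    intro P
    trivial
  | node e t₀ t₁ ih₀ ih₁ =>
    intro P
    exact ⟨hstep P e, ih₀ _, ih₁ _⟩

end Rule

end ExplorationTree

end Summit.Ventures.PercRepro2
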